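import Summits.BirchSwinnertonDyer.Rank1Residual.X2.TamagawaSqueeze
import Summits.BirchSwinnertonDyer.Rank1Residual.X1.LambdaParity
import Literature.NumberTheory.EllipticCurves.PAdicLFunctionMultiplicativeFunctionalEquationProofs
import Literature.NumberTheory.EllipticCurves.AtkinLehnerComplementEigenvalueProofs
import Literature.NumberTheory.EllipticCurves.CuspFormLFunctionLevelConductorProofs
import HarnessLib

/-!
# Class X2 (odd multiplicative Eisenstein prime): the analytic λ-invariant at `p ‖ N` has the parity
# of `r_an + e` — PROVED from the Mazur–Tate–Teitelbaum functional equation at a multiplicative prime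
# (cell `b2b-bsdres`, unit `b2b-bsdres-eisenstein-p2`, gen 6)

HONEST FRAMING (run/shared/lean/b2b/bsd-rank1-residual/, verbatim in every file): the goal of the
cell is to DELETE the COMBINATION-SHAPED residual classes of the Birch–Swinnerton-Dyer formula for
ALL analytic-rank `≤ 1` elliptic curves over `ℚ` — "full BSD formula for every rank `≤ 1` curve in
class `C`" assembled STRICTLY from published theorems — so that the rank-`≤ 1` remainder becomes
exactly the CONSTRUCTION-SHAPED classes, which are TYPED (missing-input `Prop`s), NOT attempted.
This is not "finishing BSD". Research routes; NO CLAIM BEYOND STATED CLASSES; nothing here changes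
a label. THIS FILE HAS NO NAMED FACT AND NO DEFINITION: theorems only.

WHY THIS FILE. The multiplicative twin of `X1/LambdaParity.lean` (sub-cell `eisenstein-p1` gen 5,
`λ_an ≡ r_an (mod 2)` at a good ordinary prime from the tree's functional equation
`subst_padicLFunction_eq_of_symmetry`, which needs `p ∤ N`). At a prime `p ‖ N` of multiplicative
reduction the routes of this sub-cell (P: `X2/ParitySqueeze.lean`, `X2/RankOneParitySqueeze.lean`;
T: `X2/TamagawaSqueeze.lean`; the height-free corner) carry PARITY hypotheses on the certified
`λ_an = n` ("`n + r_an` even at a non-split prime, odd at a split prime"), and the census carries a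
"parity alarm" column. Gen 6 proves the functional equation of THE Mazur–Tate–Teitelbaum `p`-adic
`L`-function at `p ‖ N` (new Literature files `AtkinLehnerSymbolSymmetryProofs` — the symmetry of
`[u/p^n]⁺` under `u ↦ −1/(Mu)`, `M = N/p`, from the Atkin–Lehner involution `w_M` —,
`PAdicMeasureFunctionalEquationProofs` — MTT §I.13/§I.17 for an arbitrary symmetric bounded measure —,
`PAdicLFunctionMultiplicativeFunctionalEquationProofs` — `L(ι(T)) = σ(1+T)^c L(T)` for every `L` of
the package, `σ = −ε_M` —, `AtkinLehnerComplementEigenvalueProofs` — `ε_M = ∏_{q ∣ M} λ(Q_q)`,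
`ε_N = λ(Q_p) ε_M`) and reads off the parity here:

* `exists_sign_eq_neg_one_pow_lam_mult` — for the newform `f` of `W` at level `N_W`, `p ≠ 2`
  multiplicative, THE `L` of the pair (`L ≠ 0`) and any `g ∈ Λ`, `c ∈ ℚ_pˣ` with `ι(g) = c·L`:
  there is `w = ±1` with `(−1)^{r_an} = w` and `(−1)^{λ(g)} = −a_p·w` (`λ(Q_p) = −a_p`, `w = −ε_N`,
  `σ = −ε_M`; `X1.LambdaParity.sign_eq_neg_one_pow_lam_of_subst_eq`): at a SPLIT prime the `p`-adic
  sign is the OPPOSITE of the complex one (the trivial zero), at a non-split prime they agree;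
* `even_lam_iff_mult` — **`λ(g) ≡ r_an (mod 2)` at a non-split prime, `λ(g) ≡ r_an + 1` at a split
  prime**;
* `analyticLambdaEq_parity` — for the cell's TYPED datum: `AnalyticMuLE W p m ∧ AnalyticLambdaEq W p n`
  at an odd multiplicative Eisenstein prime ⇒ `n + r_an` even (non-split) / odd (split), granted
  Wuthrich 2014 Thm. 16 (`hWu`, integrality: an integral `G` with `ι(G) = ϖ·L` exists) and modularity
  (`hpar`) — the "parity alarm" column is a THEOREM (census: 0 alarms on 1559 pairs);
* `mazurMainConjectureAt_of_algebraicLambdaGE_of_le` — ROUTE T with the parity hypotheses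
  DISCHARGED: `μ_an = 0 ∧ λ_an = n ∧ λ_alg ≥ k ∧ n ≤ k + e + 1 ⇒` Mazur's main conjecture at `(E,p)`
  (`r_an ≤ 1`).

References: [MazurTateTeitelbaum1986Invent] §I.10, §I.17; [Knapp1993] Lemma 9.24, Thm. 9.27;
[GreenbergLNM1716] §1 pp. 67–68, Prop. 3.10; [Wuthrich2014] Thm. 16; HOME/b2b-bsdres-eisenstein-p2/X2-GAP.md §11.
-/

noncomputable section

open scoped Classical MatrixGroups ModularForm

open PowerSeries CongruenceSubgroup WeierstrassCurve Literature.NumberTheory.EllipticCurves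
  Literature.NumberTheory.EllipticCurves.ModularForms
  Summit.BirchSwinnertonDyer.Rank1Residual.X1.MuLambda
  Summit.BirchSwinnertonDyer.Rank1Residual.X1.LambdaParity

set_option autoImplicit false

namespace Summit.BirchSwinnertonDyer.Rank1Residual.X2

section Parity

variable (W : WeierstrassCurve ℚ) [W.IsElliptic] {N : ℕ} [NeZero N]
  {f : CuspForm (Gamma0 N) 2} (p : ℕ) [Fact p.Prime]

/-- **The signs of the functional equations at a MULTIPLICATIVE prime `p ‖ N`** (Mazur–Tate–
Teitelbaum 1986, §I.17–§I.18; Greenberg–Stevens 1993, Introduction: at a split multiplicative prime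
the sign of the `p`-adic functional equation is the OPPOSITE of the complex sign — the trivial zero).
For the newform `f` of the elliptic `W/ℚ` at level `N = N_W`, a prime `p ≠ 2` of multiplicative
reduction, THE `p`-adic `L`-function `L` of the pair (`IsSplitMultPAdicLFunctionOf f p L` at a split
prime, `IsMultPAdicLFunctionOf f p (-1) L` at a non-split prime), `L ≠ 0`, and any `g ∈ Λ`,
`c ∈ ℚ_pˣ` with `ι(g) = c · L`: there is `w = ±1` with `(−1)^{r_an} = w` (the complex sign) and
`(−1)^{λ(g)} = −a_p · w` (`= −w` split, `= w` non-split). Inputs: the functional equation of `L` at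
`p ‖ N` (`IsSplitMultPAdicLFunctionOf.subst_eq_of_atkinLehner` /
`IsMultPAdicLFunctionOf.subst_eq_of_atkinLehner`: sign `−ε_M`, `w_M f = ε_M f`, `M = N/p`),
`ε_N = λ(Q_p)·ε_M` (`frickeEigenvalue_eq_mul_prod_of_level_eq_mul`), `λ(Q_p) = −a_p`
(`atkinLehnerEigenvalueAt_eq_neg_coeff_of_not_dvd`), `w = −ε_N` and `(−1)^{r_an} = w` (Hecke), and
`σ = (−1)^{λ}` from an MTT-type functional equation on `Λ` (`X1.LambdaParity.sign_eq_neg_one_pow_lam_of_subst_eq`).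
[cite: MazurTateTeitelbaum1986Invent, §I.17–I.18] [cite: Knapp1993, Thm. 9.27] -/
theorem exists_sign_eq_neg_one_pow_lam_mult (hN : N = W.conductorNorm ℤ) (hp : p ≠ 2)
    (hf : IsNewformOf W f) (hmult : W.HasMultiplicativeReductionAtPrime p) {c : ℚ_[p]} (hc : c ≠ 0)
    {L : PowerSeries ℚ_[p]}
    (hLs : W.HasSplitMultiplicativeReductionAtPrime p → IsSplitMultPAdicLFunctionOf f p L)
    (hLn : ¬ W.HasSplitMultiplicativeReductionAtPrime p → IsMultPAdicLFunctionOf f p (-1) L)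
    (hL0 : L ≠ 0) {g : IwasawaAlgebra p} (hg : iwasawaToPowerSeries p g = C c * L) :
    ∃ w : ℤ, (w = 1 ∨ w = -1) ∧ (-1 : ℂ) ^ W.analyticRank = w ∧
      (W.HasSplitMultiplicativeReductionAtPrime p → -w = (-1) ^ lam g) ∧
      (¬ W.HasSplitMultiplicativeReductionAtPrime p → w = (-1) ^ lam g) := by
  have hpP : p.Prime := Fact.out
  have hf0 : f ≠ 0 := fun h0 ↦ hf.1.coe_ne_zero (by rw [h0]; rfl)
  -- `a_p = ±1`, `p ∣ N`, `p² ∤ N`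
  obtain ⟨a, ha, hap, hpN, has⟩ : ∃ a : ℤ, (a = 1 ∨ a = -1) ∧ cuspCoeff f p = a ∧ p ∣ N ∧
      (W.HasSplitMultiplicativeReductionAtPrime p ↔ a = 1) := by
    by_cases hsplit : W.HasSplitMultiplicativeReductionAtPrime p
    · exact ⟨1, Or.inl rfl, by rw [(hf.cuspCoeff_eq_one_and_sq_of_split hsplit).1, Int.cast_one],
        hf.dvd_level_of_split hsplit, by simp [hsplit]⟩
    · obtain ⟨h1, h2⟩ := hf.cuspCoeff_eq_neg_one_and_dvd_of_nonsplit hmult hsplit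
      exact ⟨-1, Or.inr rfl, by rw [h1]; push_cast; ring, h2, by simp [hsplit]⟩
  have hLp : W.LFunction p ≠ 0 := by
    intro h0
    have e := hf.2 p
    rw [hap, h0] at e
    rcases ha with rfl | rfl <;> norm_num at e
  have hp2 : ¬ p ^ 2 ∣ N := hf.not_sq_dvd_level_of_lFunction_ne_zero hpP hLp
  -- `N = p M`, `p ∤ M`
  obtain ⟨M, hNM⟩ := hpN
  have hpM : ¬ p ∣ M := by
    rintro ⟨M', hM'⟩
    exact hp2 ⟨M', by rw [hNM, hM']; ring⟩
  haveI : NeZero M := ⟨fun h0 ↦ NeZero.ne N (by rw [hNM, h0, mul_zero])⟩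
  have hMN : M ∣ N := ⟨p, by rw [hNM, mul_comm]⟩
  have hcop : Nat.Coprime M (N / M) := by
    rw [hNM, Nat.mul_div_cancel _ (NeZero.pos M)]
    exact (Nat.Coprime.symm ((hpP.coprime_iff_not_dvd).mpr hpM))
  -- `w_M f = ε_M f`, `ε_M = ±1`; the `p`-adic sign is `σ = -ε_M`
  set εM : ℂ := ∏ q ∈ M.primeFactors, atkinLehnerEigenvalueAt f q with hεM
  have hWM : atkinLehnerInvolution N 2 M f = εM • f :=
    hf.1.atkinLehnerInvolution_eq_prod_smul_of_level_eq_mul N hpP hNM hpM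
  have hεM1 : εM = 1 ∨ εM = -1 :=
    eq_one_or_eq_neg_one_of_atkinLehnerInvolution_eq_smul N 2 M hMN hcop hf0 hWM
  obtain ⟨σ, hσ1, hσε⟩ : ∃ σ : ℤ, (σ = 1 ∨ σ = -1) ∧ (σ : ℂ) = -εM := by
    rcases hεM1 with h | h
    · exact ⟨-1, Or.inr rfl, by rw [h]; push_cast; ring⟩
    · exact ⟨1, Or.inl rfl, by rw [h]; push_cast; ring⟩
  have hσsq : σ ^ 2 = 1 := by rcases hσ1 with rfl | rfl <;> norm_num
  have hW' : atkinLehnerInvolution N 2 M f = (-(σ : ℂ)) • f := by rw [hσε, neg_neg]; exact hWM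
  -- the `p`-adic functional equation of `L`, hence of `ι(g) = c · L`
  obtain ⟨ηM, c', hc'⟩ := exists_teichmuller_exponent_natCast (p := p) hpM
  obtain ⟨ι, hι⟩ := exists_inv_sub_one (p := p)
  have hι0 : constantCoeff ι = 0 := constantCoeff_eq_zero_of_one_add_X_mul hι
  have hFE : PowerSeries.subst ι L = C ((σ : ℤ) : ℚ_[p]) * PowerSeries.binomialSeries ℚ_[p] c' * L := by
    by_cases hsplit : W.HasSplitMultiplicativeReductionAtPrime p
    · exact IsSplitMultPAdicLFunctionOf.subst_eq_of_atkinLehner hsplit hf hNM hpM hσsq hW' hc' hι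
        (hLs hsplit)
    · exact IsMultPAdicLFunctionOf.subst_eq_of_atkinLehner hf hmult hsplit hNM hpM hσsq hW' hc' hι
        (hLn hsplit)
  have hG : PowerSeries.subst ι (iwasawaToPowerSeries p g) =
      C (σ : ℚ_[p]) * PowerSeries.binomialSeries ℚ_[p] c' * iwasawaToPowerSeries p g := by
    rw [hg, subst_C_mul_of_constantCoeff_eq_zero hι0, hFE]
    ring
  have hg0 : g ≠ 0 := by
    intro h0
    rw [h0, map_zero] at hg
    have hC0 : C c ≠ (0 : ℚ_[p]⟦X⟧) := by
      rw [Ne, ← map_zero (C (R := ℚ_[p])), PowerSeries.C_injective.eq_iff]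
      exact hc
    exact mul_ne_zero hC0 hL0 hg.symm
  have hsign : σ = (-1) ^ lam g := sign_eq_neg_one_pow_lam_of_subst_eq hp hg0 hι hσ1 hG
  -- the complex side: `ε_N = λ(Q_p) ε_M = -a_p ε_M`, `w = -ε_N`, `(-1)^{r_an} = w`
  have hεN : frickeEigenvalue f = atkinLehnerEigenvalueAt f p * εM :=
    hf.1.frickeEigenvalue_eq_mul_prod_of_level_eq_mul N hpP hNM hpM
  have hlamp : atkinLehnerEigenvalueAt f p = -(a : ℂ) := by
    rw [hf.1.atkinLehnerEigenvalueAt_eq_neg_coeff_of_not_dvd p hNM hpM, ← hap]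
    rfl
  obtain ⟨ε, -, hFr⟩ := IsNewform0.exists_frickeInvolution_eq_smul_of_mainLemma0
    N 2 (atkinLehnerMainLemma0_holds 2 N) hf.1
  have hεeq : ε = frickeEigenvalue f := by
    have h2 := frickeInvolution_eq_frickeEigenvalue_smul ⟨ε, hFr⟩
    rw [hFr] at h2
    have h3 : (ε - frickeEigenvalue f) • f = 0 := by rw [sub_smul, h2, sub_self]
    exact sub_eq_zero.mp ((smul_eq_zero.mp h3).resolve_right hf0)
  -- `w := -ε_N = a ε_M = -a σ`
  set w : ℤ := -(a * σ) with hw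
  have hw1 : w = 1 ∨ w = -1 := by
    rcases ha with rfl | rfl <;> rcases hσ1 with rfl | rfl <;> simp [hw]
  have hwε : (w : ℂ) = -ε := by
    rw [hw, hεeq, hεN, hlamp]
    push_cast
    have : (σ : ℂ) = -εM := hσε
    rw [show εM = -(σ : ℂ) by rw [this, neg_neg]]
    ring
  have hE : W.HasEntireLFunction := hf.hasEntireLFunction
  obtain ⟨Λ, hΛ, hfe⟩ := exists_functional_equation_of_frickeInvolution_eq_smul
    (exists_completedCuspFormL_functional_equation_holds N 2) hFr
  subst hN
  have hC : (-1 : ℂ) ^ W.analyticRank = w :=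
    neg_one_pow_analyticRank_eq_of_hasFunctionalEquationSign W hE
      (W.hasFunctionalEquationSign_of_isNewformOf hE hf hΛ hfe hwε)
  refine ⟨w, hw1, hC, fun hsplit ↦ ?_, fun hns ↦ ?_⟩
  · have ha1 : a = 1 := has.mp hsplit
    rw [hw, ha1, one_mul, neg_neg]
    exact hsign
  · have ha1 : a = -1 := by
      rcases ha with h | h
      · exact absurd (has.mpr h) hns
      · exact h
    rw [hw, ha1, neg_mul, one_mul, neg_neg]
    exact hsign

/-- **`λ_an ≡ r_an + e (mod 2)` at a multiplicative prime.** For the newform `f` of the elliptic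
`W/ℚ` at level `N_W`, an odd prime `p` of multiplicative reduction, THE `p`-adic `L`-function `L` of
the pair, `L ≠ 0`, and any `g ∈ Λ`, `c ∈ ℚ_pˣ` with `ι(g) = c · L` (e.g. `ϖ·L = ι(T^e·h·f_E)` of
Wuthrich's Thm. 16): at a NON-split prime `λ(g)` has the parity of `r_an = ord_{s=1}L(E,s)`; at a
SPLIT prime — where `λ(g)` counts the trivial zero — the parity of `r_an + 1`.
[cite: MazurTateTeitelbaum1986Invent, §I.17–I.18] -/
theorem even_lam_iff_mult (hN : N = W.conductorNorm ℤ) (hp : p ≠ 2) (hf : IsNewformOf W f)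
    (hmult : W.HasMultiplicativeReductionAtPrime p) {c : ℚ_[p]} (hc : c ≠ 0)
    {L : PowerSeries ℚ_[p]}
    (hLs : W.HasSplitMultiplicativeReductionAtPrime p → IsSplitMultPAdicLFunctionOf f p L)
    (hLn : ¬ W.HasSplitMultiplicativeReductionAtPrime p → IsMultPAdicLFunctionOf f p (-1) L)
    (hL0 : L ≠ 0) {g : IwasawaAlgebra p} (hg : iwasawaToPowerSeries p g = C c * L) :
    (¬ W.HasSplitMultiplicativeReductionAtPrime p → (Even (lam g) ↔ Even W.analyticRank)) ∧
      (W.HasSplitMultiplicativeReductionAtPrime p → (Even (lam g) ↔ Odd W.analyticRank)) := by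
  obtain ⟨w, hw1, hC, hs, hn⟩ :=
    exists_sign_eq_neg_one_pow_lam_mult W p hN hp hf hmult hc hLs hLn hL0 hg
  have hr : Even W.analyticRank ↔ w = 1 := by
    constructor
    · intro hev
      rw [hev.neg_one_pow] at hC
      exact_mod_cast hC.symm
    · intro hw
      rw [hw, Int.cast_one] at hC
      exact (neg_one_pow_eq_one_iff_even (by norm_num)).mp hC
  constructor
  · intro hns
    rw [hr, hn hns, neg_one_pow_eq_one_iff_even (by norm_num)]
  · intro hsplit
    have h1 : Even (lam g) ↔ -w = 1 := by
      rw [hs hsplit, neg_one_pow_eq_one_iff_even (by norm_num)]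
    rw [h1, ← Nat.not_even_iff_odd, hr]
    rcases hw1 with rfl | rfl <;> norm_num

end Parity

/-! ## The parity of a certified `λ_an = n` at an X2 pair -/

section Typed

variable {W : WeierstrassCurve ℚ} [W.IsElliptic] [W.IsGloballyMinimal] {p : ℕ} [Fact p.Prime]

/-- **A certified `λ_an = n` at an odd multiplicative prime has `n ≡ r_an + e (mod 2)`** (`e = 1`
split, `0` non-split): if `AnalyticMuLE W p m` (so `ϖ·L ≠ 0`) and `AnalyticLambdaEq W p n`, then —
the data existing by modularity (`hpar`), the tree's existence theorems for THE multiplicative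
`p`-adic `L`-function, and Wuthrich 2014 Thm. 16 (`hWu`: `ϖ·L = ι(T^e·g)` with `g ∈ char_Λ X`, which
supplies an integral `G` with `ι(G) = ϖ·L`) — `n + r_an` is even at a non-split prime and odd at a
split prime. The parity hypotheses of `X2.mazurMainConjectureAt_of_algebraicLambdaGE_of_parity`
(route T), of route P and of the census's "parity alarm" column are therefore THEOREMS.
[cite: MazurTateTeitelbaum1986Invent, §I.17–I.18] [cite: Wuthrich2014, Thm. 16 (p. 397)] -/
theorem analyticLambdaEq_parity
    (hWu : Wuthrich2014.thm16_charIdeal_dvd_multiplicative_of_reducible)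
    (hpar : nonempty_modularParametrizationData)
    (W : WeierstrassCurve ℚ) [W.IsElliptic] [W.IsGloballyMinimal] (p : ℕ) [Fact p.Prime]
    (hp2 : p ≠ 2) (hmult : W.HasMultiplicativeReductionAtPrime p)
    (hred : ¬ W.HasIrreducibleModPGaloisRep p) {n m : ℕ}
    (hμ : AnalyticMuLE W p m) (hlam : AnalyticLambdaEq W p n) :
    (¬ W.HasSplitMultiplicativeReductionAtPrime p → Even (n + W.analyticRank)) ∧
      (W.HasSplitMultiplicativeReductionAtPrime p → Odd (n + W.analyticRank)) := by
  haveI : NeZero (W.conductorNorm ℤ) := ⟨(W.conductorNorm_pos_holds).ne'⟩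
  obtain ⟨Dm⟩ := hpar W
  have hf : IsNewformOf W Dm.f := Dm.isNewformOf
  obtain ⟨ϖ, -, hϖeq, -⟩ := Dm.exists_rat_mul_realPeriodRat_eq_plusPeriod
  have hϖ0 : ϖ ≠ 0 := varpi_ne_zero_of_isNewformOf hf hϖeq
  have hϖQ0 : ((ϖ : ℚ) : ℚ_[p]) ≠ 0 := by exact_mod_cast hϖ0
  obtain ⟨κ, hκ, γ, hγ, hγ'⟩ := exists_isCyclotomic_isTopGenerator_isCyclotomicVariable_holds p
  obtain ⟨D⟩ := W.nonempty_selmerDualData_holds κ γ hγ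
  haveI : Module.Finite (IwasawaAlgebra p) D.X := D.module_finite_holds hγ
  obtain ⟨-, hKns, hKs⟩ := hWu W p hp2 hmult hred hκ hγ hγ' hf D ϖ hϖeq
  -- THE `p`-adic `L`-function and an integral `G` with `ι(G) = ϖ·L`
  obtain ⟨L, hLs, hLn, G, hG⟩ : ∃ L : PowerSeries ℚ_[p],
      (W.HasSplitMultiplicativeReductionAtPrime p → IsSplitMultPAdicLFunctionOf Dm.f p L) ∧
      (¬ W.HasSplitMultiplicativeReductionAtPrime p → IsMultPAdicLFunctionOf Dm.f p (-1) L) ∧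
      ∃ G : IwasawaAlgebra p, iwasawaToPowerSeries p G = C ((ϖ : ℚ) : ℚ_[p]) * L := by
    by_cases hsplit : W.HasSplitMultiplicativeReductionAtPrime p
    · obtain ⟨L, hL⟩ := exists_isSplitMultPAdicLFunctionOf hsplit hf
      obtain ⟨g, -, hιg⟩ := hKs hsplit L hL
      exact ⟨L, fun _ ↦ hL, fun hns ↦ absurd hsplit hns, PowerSeries.X * g, hιg⟩
    · obtain ⟨L, hL⟩ := exists_isMultPAdicLFunctionOf_neg_one_of_nonsplit hf hmult hsplit
      obtain ⟨g, -, hιg⟩ := hKns hsplit L hL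
      exact ⟨L, fun hs ↦ absurd hs hsplit, fun _ ↦ hL, g, hιg⟩
  -- `ϖ·L ≠ 0` by the μ-certificate; `λ(G) = n`
  obtain ⟨k', hk'⟩ := hμ Dm.f hf ϖ hϖeq L hLs hLn
  have hL0 : L ≠ 0 := by
    intro h0
    rw [h0, mul_zero, map_zero, norm_zero] at hk'
    exact not_le.mpr hk' (by positivity)
  have hlamG : lam G = n := hlam Dm.f hf ϖ hϖeq L hLs hLn G hG
  obtain ⟨hn, hs⟩ := even_lam_iff_mult W p rfl hp2 hf hmult hϖQ0 hLs hLn hL0 hG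
  rw [hlamG] at hn hs
  constructor
  · intro hns
    rcases Nat.even_or_odd n with hev | hod
    · exact hev.add (((hn hns).mp hev))
    · have hro : Odd W.analyticRank := by
        rw [← Nat.not_even_iff_odd, ← hn hns, Nat.not_even_iff_odd]; exact hod
      exact hod.add_odd hro
  · intro hsplit
    rcases Nat.even_or_odd n with hev | hod
    · exact hev.add_odd ((hs hsplit).mp hev)
    · have hre : Even W.analyticRank := by
        rw [← Nat.not_odd_iff_even, ← hs hsplit, Nat.not_even_iff_odd]; exact hod
      exact hod.add_even hre

end Typed

/-! ## Route T with the parity hypotheses discharged -/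

section RouteT

open Literature.NumberTheory.EllipticCurves.Rank1Residual
  Literature.NumberTheory.EllipticCurves.Wuthrich2014
  Literature.NumberTheory.EllipticCurves.Greenberg1999
  Summit.BirchSwinnertonDyer.Rank1Residual.X1.ParitySqueeze
  Summit.BirchSwinnertonDyer.Rank1Residual.X1.TamagawaSqueeze

/-- **Route T at an odd multiplicative Eisenstein prime, parity DISCHARGED (analytic rank `≤ 1`).**
`μ_an = 0` (`AnalyticMuLE W p 0`), `λ_an = n` (`AnalyticLambdaEq W p n`), `λ_alg ≥ k`
(`AlgebraicLambdaGE W p k`) with `n ≤ k + 1` at a non-split prime / `n ≤ k + 2` at a split prime ⇒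
`X2.MazurMainConjectureAt W p`: the parity `n ≡ r_an + e (mod 2)` demanded by
`X2.mazurMainConjectureAt_of_algebraicLambdaGE_of_parity` is `analyticLambdaEq_parity`. PUBLISHED
named facts (hypotheses): Wuthrich 2014 Thm. 16 (`hWu`), Greenberg 1999 Prop. 3.10 (`h310`),
Gross–Zagier–Kolyvagin (`hGZK`), modularity (`hpar`). [cite: MazurTateTeitelbaum1986Invent, §I.17]
[cite: GreenbergLNM1716, Prop. 3.10 and Cor. 5.6 (proof, p. 136)] [cite: Wuthrich2014, Thm. 16 (p. 397)] -/
theorem mazurMainConjectureAt_of_algebraicLambdaGE_of_le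
    (hWu : thm16_charIdeal_dvd_multiplicative_of_reducible)
    (h310 : prop310_selmerCorank_mod_two_eq_lambdaInvariant)
    (hGZK : rank_eq_analyticRank_of_analyticRank_le_one)
    (hpar : nonempty_modularParametrizationData)
    (W : WeierstrassCurve ℚ) [W.IsElliptic] [W.IsGloballyMinimal] (p : ℕ) [Fact p.Prime]
    (hp2 : p ≠ 2) (hmult : W.HasMultiplicativeReductionAtPrime p)
    (hred : ¬ W.HasIrreducibleModPGaloisRep p) (hr : W.analyticRank ≤ 1) {n k : ℕ}
    (hμ0 : AnalyticMuLE W p 0) (hlam : AnalyticLambdaEq W p n) (halg : AlgebraicLambdaGE W p k)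
    (hkN : ¬ W.HasSplitMultiplicativeReductionAtPrime p → n ≤ k + 1)
    (hkS : W.HasSplitMultiplicativeReductionAtPrime p → n ≤ k + 2) :
    X2.MazurMainConjectureAt W p := by
  obtain ⟨hn, hs⟩ := analyticLambdaEq_parity hWu hpar W p hp2 hmult hred hμ0 hlam
  exact mazurMainConjectureAt_of_algebraicLambdaGE_of_parity hWu h310 hGZK W p hp2 hmult hred hr hμ0
    hlam halg (fun hns ↦ ⟨hkN hns, hn hns⟩) (fun hsp ↦ ⟨hkS hsp, hs hsp⟩)

end RouteT

end Summit.BirchSwinnertonDyer.Rank1Residual.X2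

end
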